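import Mathlib

/-! Triage k=3: cheap attack on card `pair-shadow-identity`, first lemma `PairShadowIdentity` AS TYPED
(verbatim copy of `Cruxes/PrimeDensityDecay/SketchK1.lean`, which is not built on the farm): it assumes only
`(A i).Nonempty`; with `B j = ∅` the left side is `∅` but the right side contains `0`.
Witness: p = 2, n = 1, A = ![{0}], B = ![∅].  Repair: add `(∀ i, (B i).Nonempty)` (or use balance with 1 ≤ s). -/

open scoped BigOperators Pointwise
open Finset

namespace TriageK3

/-- verbatim from SketchK1.lean -/
def PairShadowIdentity : Prop :=
  ∀ (p n : ℕ) (A B : Fin n → Finset (ZMod p)),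
    (∀ i : Fin n, (A i).Nonempty) →
    (∀ i : Fin n, ∀ a ∈ A i, ∀ a' ∈ A i, ∀ b ∈ B i, ∀ b' ∈ B i, (a - a') + (b - b') = 0 → a = a' ∧ b = b') →
    (∀ i j k : Fin n, ∀ a ∈ A i, ∀ a' ∈ A j, ∀ b ∈ B j, ∀ b' ∈ B k, (a - a') + (b - b') = 0 → i = k) →
    ∀ j : Fin n,
      (Finset.univ.biUnion A - A j) ∩ (Finset.univ.biUnion B - B j) =
        {0} ∪ (Finset.univ.filter (fun i => i ≠ j)).biUnion (fun i => (A i - A j) ∩ (B i - B j))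

theorem pairShadowIdentity_false_as_typed : ¬ PairShadowIdentity := by
  intro h
  have h1 := h 2 1 ![{0}] ![∅] (by decide) (by decide) (by decide) 0
  revert h1
  decide

/-- The repaired statement (both families nonempty). -/
def PairShadowIdentity' : Prop :=
  ∀ (p n : ℕ) (A B : Fin n → Finset (ZMod p)),
    (∀ i : Fin n, (A i).Nonempty) → (∀ i : Fin n, (B i).Nonempty) →
    (∀ i : Fin n, ∀ a ∈ A i, ∀ a' ∈ A i, ∀ b ∈ B i, ∀ b' ∈ B i, (a - a') + (b - b') = 0 → a = a' ∧ b = b') →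
    (∀ i j k : Fin n, ∀ a ∈ A i, ∀ a' ∈ A j, ∀ b ∈ B j, ∀ b' ∈ B k, (a - a') + (b - b') = 0 → i = k) →
    ∀ j : Fin n,
      (Finset.univ.biUnion A - A j) ∩ (Finset.univ.biUnion B - B j) =
        {0} ∪ (Finset.univ.filter (fun i => i ≠ j)).biUnion (fun i => (A i - A j) ∩ (B i - B j))

theorem pairShadowIdentity'_holds : PairShadowIdentity' := by
  intro p n A B hA hB hW hX j
  ext d
  simp only [Finset.mem_inter, Finset.mem_sub, Finset.mem_biUnion, Finset.mem_univ, true_and,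
    Finset.mem_union, Finset.mem_singleton, Finset.mem_filter]
  constructor
  · rintro ⟨⟨x, ⟨i, hx⟩, a', ha', rfl⟩, ⟨y, ⟨k, hy⟩, b, hb, hyb⟩⟩
    have hik : i = k := hX i j k x hx a' ha' b hb y hy (by rw [← hyb]; ring)
    subst hik
    by_cases hij : i = j
    · subst hij
      left
      have := hW i x hx a' ha' b hb y hy (by rw [← hyb]; ring)
      rw [this.1, sub_self]
    · right
      exact ⟨i, hij, ⟨x, hx, a', ha', rfl⟩, ⟨y, hy, b, hb, hyb⟩⟩
  · rintro (rfl | ⟨i, _, ⟨x, hx, a', ha', hxa⟩, ⟨y, hy, b, hb, hyb⟩⟩)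
    · obtain ⟨a, ha⟩ := hA j
      obtain ⟨b, hb⟩ := hB j
      exact ⟨⟨a, ⟨j, ha⟩, a, ha, sub_self a⟩, ⟨b, ⟨j, hb⟩, b, hb, sub_self b⟩⟩
    · exact ⟨⟨x, ⟨i, hx⟩, a', ha', hxa⟩, ⟨y, ⟨i, hy⟩, b, hb, hyb⟩⟩

/-- verbatim from SketchK1.lean: the coincidence pieces are pairwise disjoint. TRUE — in fact without
`i ≠ j`, `i' ≠ j` or (W): a common element `d = a - a' = b' - b` with `a ∈ A i`, `a' ∈ A j`, `b ∈ B j`,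
`b' ∈ B i'` gives `i = i'` by (X). -/
def PairShadowDisjoint : Prop :=
  ∀ (p n : ℕ) (A B : Fin n → Finset (ZMod p)),
    (∀ i : Fin n, ∀ a ∈ A i, ∀ a' ∈ A i, ∀ b ∈ B i, ∀ b' ∈ B i, (a - a') + (b - b') = 0 → a = a' ∧ b = b') →
    (∀ i j k : Fin n, ∀ a ∈ A i, ∀ a' ∈ A j, ∀ b ∈ B j, ∀ b' ∈ B k, (a - a') + (b - b') = 0 → i = k) →
    ∀ j i i' : Fin n, i ≠ j → i' ≠ j → i ≠ i' →
      Disjoint ((A i - A j) ∩ (B i - B j)) ((A i' - A j) ∩ (B i' - B j))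

theorem pairShadowDisjoint_holds : PairShadowDisjoint := by
  intro p n A B _hW hX j i i' _ _ hii'
  rw [Finset.disjoint_left]
  intro d hd hd'
  simp only [Finset.mem_inter, Finset.mem_sub] at hd hd'
  obtain ⟨⟨x, hx, a', ha', rfl⟩, -⟩ := hd
  obtain ⟨-, ⟨y, hy, b, hb, hyb⟩⟩ := hd'
  exact hii' (hX i j i' x hx a' ha' b hb y hy (by rw [← hyb]; ring))

end TriageK3
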